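import Literature.IUT.HodgeArakelov.LabelClassesOfCuspsLevelCount
import Literature.IUT.HodgeArakelov.FlTorsorStructureConjRigidity
import HarnessLib

/-!
# [IUTchII] Def 2.3 (iii)/(v): the NATURAL LEVEL MAP `LabCusp^±(Π_v) → LabCusp^±(Π̂^±_v)` between two homogeneous levels — existence,
# uniqueness, injectivity, bijectivity — and the tie of the `𝔽^±_l`-torsor chart to the level-`Π_v` structure (GAP-LEDGER G-w5d243-2)

S. Mochizuki, *Inter-universal Teichmüller theory II*, kurims manuscript (Dec. 2020), §2 Def 2.3 (ii) p. 68 («the cuspidal inertia groups of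
`Π_⊇` may be obtained as the `Π_⊇`-conjugates of the commensurators [or normalizers] in `Π_⊇` of the cuspidal inertia groups of `Π_⊆`»), (iii)
p. 68 (`LabCusp^±(Π_⊆)`), (v) p. 69 («the images … in `LabCusp^±(Π_⊆)` of the various structures on `LabCusp^±(Π_v)` reviewed in (iii) determine
[cf. [IUTchI], Definition 6.1, (i)] a natural `𝔽^±_l`-torsor structure on `LabCusp^±(Π_⊆)` … hence determines a natural outer isomorphism
`Π_⊇/Π_⊆ ≅ 𝔽_l^{⋊±}`») [claim: Mochizuki2012, status: disputed] (IUTchII §2 Def 2.3 (v), kurims p.69) (D-0012 claim key; record-only typing;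
nothing printed is asserted here).

abc-iut cell, seat abc-iut-w5-d132 (gen 7), GAP-LEDGER row **G-w5d243-2** («typed too weak»: abc-iut-L6-t1's `FlTorsorStructure C` / the
successor `FlTorsorStructureConj C` carry NO map `LabCusp^±(Π_v) → LabCusp^±(Π̂^±_v)`, so the chart `LabCusp^±(Π̂^±_v) ≃ 𝔽_l` is not tied to the
level-`Π_v` structures of Def 2.3 (iii); wanted: DATA `imageV` and LAW `chart_imageV : ∃ a ε, ∀ t, F.chart (imageV t) = ε · L.toFl t + a`).
PROOF-ONLY disposition (no `def`, no instance, no named fact; the def-bearing interface fields stay the interface owner's), PURE GROUP THEORY over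
the typed interface (`CuspidalInertiaData`, `labelRel`, `LabCuspPM`, `LabCuspStructure`, `FlTorsorStructureConj`):

§1 THE LEVEL MAP.  Level 1 = a level `Π_⊆ ⊆ Π_⊇ ≤ R` whose cuspidal groups are EXACTLY the `R`-conjugates of one `J₁ ≤ Π_⊇` (`R` normalising
`Π_⊇`; at the genuine tower: `Π_v ⊆ Π^±_v ≤ ι(inclX Π^tp_X)`, abc-iut-w5-d132 p456452 `isCuspidalInertia_piV_iff_rangeX`); level 2 = the hatted level
`Π̂^±_v ⊆ Π̂^±_v` whose cuspidal groups are EXACTLY the `Π̂^cor_v`-conjugates of one `J₂ ≤ Π̂^±_v` (p448608 `isCuspidalInertia_pmHat_iff`).  Print's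
recipe (Def 2.3 (ii): pass to the larger group by conjugating normalisers / closures) sends `r J₁ r⁻¹ ↦ r J₂ r⁻¹`; the kernel statements:
* `labelRel_hat_of_inv_mul_mem_pmHat` / `inv_mul_mem_of_labelRel_level` — the two coset computations behind well-definedness;
* **`exists_levelMap`** — if the level-1 stabiliser is `Π_⊇` itself (`N(N(J₁) ∩ Π_⊇) ∩ R ≤ Π_⊇`) and `Π_⊇ ≤ Π̂^±_v`, there IS a map
  `f : LabCusp^±(Π_⊆) → LabCusp^±(Π̂^±_v)` with `f ⟦r J₁ r⁻¹⟧ = ⟦r J₂ r⁻¹⟧` for every `r ∈ R` («imageV» EXISTS as a function of the group data);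
* **`levelMap_unique`** — any two such maps coincide (every class is some `⟦r J₁ r⁻¹⟧`);
* **`levelMap_injective`** — if the level-2 stabiliser meets `R` inside `Π_⊇` (`(N(N(J₂) ∩ Π̂^±_v) · Π̂^±_v) ∩ R ≤ Π_⊇`), `f` is INJECTIVE;
  `sup_inf_le_pmHat_of_inputs` — that stabiliser meets `Π̂_X` inside `Π̂^±_v` under the SAME inputs as the hatted count p447018
  `card_labCuspPM_eq_l_of_inputs` (decomposition group `D`, cusp separation `N(J₂) ∩ Π̂_X ≤ D`, `J₂` stable under `N(D)`);
* **`levelMap_bijective_of_card_eq`** — injective + equal finite counts (both `= l` at the genuine tower: p449023, p456452) ⇒ BIJECTIVE.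
§2 THE TIE (law (b) of G-w5d243-2).
* **`exists_labCuspStructure_toFl_eq_chart_comp`** — for a bijective level map `f` and ANY torsor datum `F : FlTorsorStructure C₂` there is a
  level-`Π_v` structure `L : LabCuspStructure C₁` (Def 2.3 (iii): `𝔽_l^×`-action, `η^0`, `η^±`) with `L.toFl = F.chart ∘ f` — the law
  `chart_imageV` is SATISFIABLE (with `ε = 1`, `a = 0`): «the images of the structures on `LabCusp^±(Π_v)`» and the chart AGREE;
* **`exists_quotIso_eq_conj_of_chart_comp_affine`** — RIGIDITY UNDER THE LAW: if two successor structures `F F' : FlTorsorStructureConj C₂`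
  both satisfy `chart_imageV` against the SAME `(L, f)` (`f` surjective), their charts lie in one `𝔽_l^{⋊±}`-orbit and their isomorphisms
  `Π̂^cor_v/Π̂^±_v ≃* 𝔽_l^{⋊±}` are CONJUGATE (abc-iut-w5-d243 p441293 `exists_quotIso_eq_conj`) — «hence determines a natural OUTER isomorphism»;
  without the law the outer class is pinned only up to `(a, ε) ↦ (c·a, ε)`, `c ∈ 𝔽_l^×` (p441293 `exists_quotIso_not_conj`).
The genuine-tower instance (`PlusMinusTower.ofCoverModel` / `ofPiCHat`) is the companion `LabelClassesOfCuspsLevelTieGenuine.lean`.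

HONEST LABEL: kernel theorems about the typed interface; the two data `C₁`, `C₂` may coincide (a merged datum of record, MERGE-MAP) or be the
split pair of record (level-`Π_v` datum p456452 / profinite datum p432649); every anabelian input is an explicit binder.  No side taken on
[IUTchIII] Cor 3.12; typed ≠ proved; nothing here asserts abc proved or refuted.
-/

noncomputable section

open scoped Pointwise

namespace Literature.IUT.HodgeArakelov

universe u

variable {S : BadPlaceSetting.{u}} {P : TopGroup.{u}} {T : TemperedCoverings S P} {W : PlusMinusTower T}

/-! ## 1. The level map between two homogeneous levels -/

section LevelMap

variable {C₁ C₂ : CuspidalInertiaData W} {Qsub Qsup R J₁ J₂ : Subgroup W.Corhat}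

/-- Level 2 (hatted): if `a⁻¹ b ∈ Π̂^±_v` then `a J₂ a⁻¹ ~ b J₂ b⁻¹` in `LabCusp^±(Π̂^±_v)` (`Π̂^±_v` lies in the stabiliser
`N(N(J₂) ∩ Π̂^±_v) · Π̂^±_v` of p447018 `labelRel_conj_smul_iff`). [claim: Mochizuki2012, status: disputed] (IUTchII §2 Def 2.3 (iii), kurims p.68) -/
theorem labelRel_hat_of_inv_mul_mem_pmHat (hJ₂ : J₂ ≤ W.pmHat) {a b : W.Corhat}
    (ha : C₂.IsCuspidalInertia W.pmHat (MulAut.conj a • J₂)) (hb : C₂.IsCuspidalInertia W.pmHat (MulAut.conj b • J₂))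
    (hab : a⁻¹ * b ∈ W.pmHat) : labelRel C₂ W.pmHat W.pmHat ⟨_, ha⟩ ⟨_, hb⟩ :=
  (labelRel_conj_smul_iff hJ₂ ha hb).mpr (Subgroup.mem_sup_right hab)

/-- Level 1: if the level-1 stabiliser is `Π_⊇` itself — `N(N(J₁) ∩ Π_⊇) ∩ R ≤ Π_⊇` (at the genuine tower: `N(ι inclX D_{x₀}) ∩ ι(inclX Π^tp_X) ≤ Π^±_v`,
[SemiAnbd] Thm 6.5 (ii), p456452) — then `a J₁ a⁻¹ ~ b J₁ b⁻¹` for `a, b ∈ R` forces `a⁻¹ b ∈ Π_⊇`.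
[claim: Mochizuki2012, status: disputed] (IUTchII §2 Def 2.3 (iii), kurims p.68) -/
theorem inv_mul_mem_of_labelRel_level (hJ₁ : J₁ ≤ Qsup) (hQR : Qsup ≤ R) (hRQ : ∀ r ∈ R, MulAut.conj r • Qsup = Qsup)
    (hstab : Subgroup.normalizer ((Subgroup.normalizer (J₁ : Set W.Corhat) ⊓ Qsup : Subgroup W.Corhat) : Set W.Corhat) ⊓ R ≤ Qsup)
    {a b : W.Corhat} (haR : a ∈ R) (hbR : b ∈ R)
    (ha : C₁.IsCuspidalInertia Qsub (MulAut.conj a • J₁)) (hb : C₁.IsCuspidalInertia Qsub (MulAut.conj b • J₁))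
    (h : labelRel C₁ Qsub Qsup ⟨_, ha⟩ ⟨_, hb⟩) : a⁻¹ * b ∈ Qsup := by
  obtain ⟨p, hp, n, hn, hab⟩ := (labelRel_conj_smul_iff_of hJ₁ hRQ haR hbR ha hb).mp h
  have hnR : n ∈ R := by
    have : n = p⁻¹ * (a⁻¹ * b) := by rw [hab, inv_mul_cancel_left]
    rw [this]
    exact R.mul_mem (R.inv_mem (hQR hp)) (R.mul_mem (R.inv_mem haR) hbR)
  rw [hab]
  exact Qsup.mul_mem hp (hstab ⟨hn, hnR⟩)

/-- Conversely `a⁻¹ b ∈ Π_⊇` (`a, b ∈ R`) gives `a J₁ a⁻¹ ~ b J₁ b⁻¹` at level 1 (witness `p = a⁻¹ b`, `n = 1`).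
[claim: Mochizuki2012, status: disputed] (IUTchII §2 Def 2.3 (iii), kurims p.68) -/
theorem labelRel_level_of_inv_mul_mem (hJ₁ : J₁ ≤ Qsup) (hRQ : ∀ r ∈ R, MulAut.conj r • Qsup = Qsup)
    {a b : W.Corhat} (haR : a ∈ R) (hbR : b ∈ R)
    (ha : C₁.IsCuspidalInertia Qsub (MulAut.conj a • J₁)) (hb : C₁.IsCuspidalInertia Qsub (MulAut.conj b • J₁))
    (hab : a⁻¹ * b ∈ Qsup) : labelRel C₁ Qsub Qsup ⟨_, ha⟩ ⟨_, hb⟩ :=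
  (labelRel_conj_smul_iff_of hJ₁ hRQ haR hbR ha hb).mpr ⟨a⁻¹ * b, hab, 1, Subgroup.one_mem _, (mul_one _).symm⟩

/-- Two presentations `r J₁ r⁻¹ = r' J₁ r'⁻¹` (`r, r' ∈ R`) of one level-1 cusp have `r⁻¹ r' ∈ Π_⊇` (the reflexive case of
`inv_mul_mem_of_labelRel_level`). [claim: Mochizuki2012, status: disputed] (IUTchII §2 Def 2.3 (iii), kurims p.68) -/
theorem inv_mul_mem_of_conj_smul_eq (hJ₁ : J₁ ≤ Qsup) (hQR : Qsup ≤ R) (hRQ : ∀ r ∈ R, MulAut.conj r • Qsup = Qsup)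
    (hC₁ : ∀ J, C₁.IsCuspidalInertia Qsub J ↔ ∃ r ∈ R, J = MulAut.conj r • J₁)
    (hstab : Subgroup.normalizer ((Subgroup.normalizer (J₁ : Set W.Corhat) ⊓ Qsup : Subgroup W.Corhat) : Set W.Corhat) ⊓ R ≤ Qsup)
    {r r' : W.Corhat} (hr : r ∈ R) (hr' : r' ∈ R) (h : MulAut.conj r • J₁ = MulAut.conj r' • J₁) : r⁻¹ * r' ∈ Qsup := by
  have hc : C₁.IsCuspidalInertia Qsub (MulAut.conj r • J₁) := (hC₁ _).mpr ⟨r, hr, rfl⟩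
  have hc' : C₁.IsCuspidalInertia Qsub (MulAut.conj r' • J₁) := (hC₁ _).mpr ⟨r', hr', rfl⟩
  refine inv_mul_mem_of_labelRel_level hJ₁ hQR hRQ hstab hr hr' hc hc' ?_
  have e : (⟨MulAut.conj r • J₁, hc⟩ : {I // C₁.IsCuspidalInertia Qsub I}) = ⟨MulAut.conj r' • J₁, hc'⟩ := Subtype.ext h
  rw [e]
  exact labelRel_refl C₁ Qsub Qsup _

/-- **THE LEVEL MAP EXISTS («imageV»).**  Two homogeneous levels — level 1: the cusps of `Π_⊆` are the `R`-conjugates of `J₁ ≤ Π_⊇ ≤ R`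
(`R` normalising `Π_⊇`), with level-1 stabiliser `Π_⊇` (`N(N(J₁) ∩ Π_⊇) ∩ R ≤ Π_⊇`) and `Π_⊇ ≤ Π̂^±_v`; level 2: the cusps of `Π̂^±_v` are the
`Π̂^cor_v`-conjugates of `J₂ ≤ Π̂^±_v`.  Then there is `f : LabCusp^±(Π_⊆) → LabCusp^±(Π̂^±_v)` with `f ⟦r J₁ r⁻¹⟧ = ⟦r J₂ r⁻¹⟧` for all `r ∈ R`
(print, Def 2.3 (ii)/(v): the class of a cusp of the smaller group goes to the class of the cusp of the larger group it determines).
[claim: Mochizuki2012, status: disputed] (IUTchII §2 Def 2.3 (v), kurims p.69) -/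
theorem exists_levelMap (hJ₁ : J₁ ≤ Qsup) (hQR : Qsup ≤ R) (hRQ : ∀ r ∈ R, MulAut.conj r • Qsup = Qsup)
    (hC₁ : ∀ J, C₁.IsCuspidalInertia Qsub J ↔ ∃ r ∈ R, J = MulAut.conj r • J₁)
    (hstab : Subgroup.normalizer ((Subgroup.normalizer (J₁ : Set W.Corhat) ⊓ Qsup : Subgroup W.Corhat) : Set W.Corhat) ⊓ R ≤ Qsup)
    (hQ : Qsup ≤ W.pmHat) (hJ₂ : J₂ ≤ W.pmHat)
    (hC₂ : ∀ J, C₂.IsCuspidalInertia W.pmHat J ↔ ∃ q : W.Corhat, J = MulAut.conj q • J₂) :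
    ∃ f : LabCuspPM C₁ Qsub Qsup → LabCuspPM C₂ W.pmHat W.pmHat,
      ∀ r ∈ R, ∀ (I : {I // C₁.IsCuspidalInertia Qsub I}) (J : {I // C₂.IsCuspidalInertia W.pmHat I}),
        I.1 = MulAut.conj r • J₁ → J.1 = MulAut.conj r • J₂ → f (Quot.mk _ I) = Quot.mk _ J := by
  classical
  have hcusp₂ : ∀ q : W.Corhat, C₂.IsCuspidalInertia W.pmHat (MulAut.conj q • J₂) := fun q => (hC₂ _).mpr ⟨q, rfl⟩
  -- a representative `r(I) ∈ R` for every level-1 cusp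
  have hrep : ∀ I : {I // C₁.IsCuspidalInertia Qsub I}, ∃ r ∈ R, I.1 = MulAut.conj r • J₁ := fun I => (hC₁ I.1).mp I.2
  choose ρ hρR hρ using hrep
  let g : {I // C₁.IsCuspidalInertia Qsub I} → LabCuspPM C₂ W.pmHat W.pmHat := fun I => Quot.mk _ ⟨_, hcusp₂ (ρ I)⟩
  -- `g` is constant on label classes
  have hg : ∀ I I' : {I // C₁.IsCuspidalInertia Qsub I}, labelRel C₁ Qsub Qsup I I' → g I = g I' := by
    intro I I' hII'
    have hc : C₁.IsCuspidalInertia Qsub (MulAut.conj (ρ I) • J₁) := (hC₁ _).mpr ⟨ρ I, hρR I, rfl⟩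
    have hc' : C₁.IsCuspidalInertia Qsub (MulAut.conj (ρ I') • J₁) := (hC₁ _).mpr ⟨ρ I', hρR I', rfl⟩
    have e : I = ⟨MulAut.conj (ρ I) • J₁, hc⟩ := Subtype.ext (hρ I)
    have e' : I' = ⟨MulAut.conj (ρ I') • J₁, hc'⟩ := Subtype.ext (hρ I')
    rw [e, e'] at hII'
    have hmem : (ρ I)⁻¹ * ρ I' ∈ Qsup := inv_mul_mem_of_labelRel_level hJ₁ hQR hRQ hstab (hρR I) (hρR I') hc hc' hII'
    exact Quot.sound (labelRel_hat_of_inv_mul_mem_pmHat hJ₂ (hcusp₂ _) (hcusp₂ _) (hQ hmem))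
  refine ⟨Quot.lift g hg, fun r hr I J hI hJ => ?_⟩
  change g I = Quot.mk _ J
  -- `I = ρ(I) J₁ ρ(I)⁻¹ = r J₁ r⁻¹`, so `ρ(I)⁻¹ r ∈ Π_⊇ ≤ Π̂^±_v`
  have hmem : (ρ I)⁻¹ * r ∈ Qsup := inv_mul_mem_of_conj_smul_eq hJ₁ hQR hRQ hC₁ hstab (hρR I) hr ((hρ I).symm.trans hI)
  have eJ : J = ⟨MulAut.conj r • J₂, hcusp₂ r⟩ := Subtype.ext hJ
  rw [eJ]
  exact Quot.sound (labelRel_hat_of_inv_mul_mem_pmHat hJ₂ (hcusp₂ _) (hcusp₂ _) (hQ hmem))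

/-- **THE LEVEL MAP IS UNIQUE**: any two maps `LabCusp^±(Π_⊆) → LabCusp^±(Π̂^±_v)` with `⟦r J₁ r⁻¹⟧ ↦ ⟦r J₂ r⁻¹⟧` (`r ∈ R`) coincide — every
level-1 class is `⟦r J₁ r⁻¹⟧` for some `r ∈ R`. [claim: Mochizuki2012, status: disputed] (IUTchII §2 Def 2.3 (v), kurims p.69) -/
theorem levelMap_unique (hC₁ : ∀ J, C₁.IsCuspidalInertia Qsub J ↔ ∃ r ∈ R, J = MulAut.conj r • J₁)
    (hC₂ : ∀ J, C₂.IsCuspidalInertia W.pmHat J ↔ ∃ q : W.Corhat, J = MulAut.conj q • J₂)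
    {f f' : LabCuspPM C₁ Qsub Qsup → LabCuspPM C₂ W.pmHat W.pmHat}
    (hf : ∀ r ∈ R, ∀ (I : {I // C₁.IsCuspidalInertia Qsub I}) (J : {I // C₂.IsCuspidalInertia W.pmHat I}),
      I.1 = MulAut.conj r • J₁ → J.1 = MulAut.conj r • J₂ → f (Quot.mk _ I) = Quot.mk _ J)
    (hf' : ∀ r ∈ R, ∀ (I : {I // C₁.IsCuspidalInertia Qsub I}) (J : {I // C₂.IsCuspidalInertia W.pmHat I}),
      I.1 = MulAut.conj r • J₁ → J.1 = MulAut.conj r • J₂ → f' (Quot.mk _ I) = Quot.mk _ J) :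
    f = f' := by
  funext t
  induction t using Quot.ind with
  | mk I =>
    obtain ⟨r, hr, hI⟩ := (hC₁ I.1).mp I.2
    have hJ : C₂.IsCuspidalInertia W.pmHat (MulAut.conj r • J₂) := (hC₂ _).mpr ⟨r, rfl⟩
    rw [hf r hr I ⟨_, hJ⟩ hI rfl, hf' r hr I ⟨_, hJ⟩ hI rfl]

/-- **THE LEVEL MAP IS INJECTIVE** when the level-2 stabiliser meets `R` inside `Π_⊇`: `(N(N(J₂) ∩ Π̂^±_v) · Π̂^±_v) ∩ R ≤ Π_⊇`.
[claim: Mochizuki2012, status: disputed] (IUTchII §2 Def 2.3 (v), kurims p.69) -/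
theorem levelMap_injective (hJ₁ : J₁ ≤ Qsup) (hRQ : ∀ r ∈ R, MulAut.conj r • Qsup = Qsup)
    (hC₁ : ∀ J, C₁.IsCuspidalInertia Qsub J ↔ ∃ r ∈ R, J = MulAut.conj r • J₁) (hJ₂ : J₂ ≤ W.pmHat)
    (hC₂ : ∀ J, C₂.IsCuspidalInertia W.pmHat J ↔ ∃ q : W.Corhat, J = MulAut.conj q • J₂)
    (hinj : (Subgroup.normalizer ((Subgroup.normalizer (J₂ : Set W.Corhat) ⊓ W.pmHat : Subgroup W.Corhat) : Set W.Corhat) ⊔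
        W.pmHat) ⊓ R ≤ Qsup)
    {f : LabCuspPM C₁ Qsub Qsup → LabCuspPM C₂ W.pmHat W.pmHat}
    (hf : ∀ r ∈ R, ∀ (I : {I // C₁.IsCuspidalInertia Qsub I}) (J : {I // C₂.IsCuspidalInertia W.pmHat I}),
      I.1 = MulAut.conj r • J₁ → J.1 = MulAut.conj r • J₂ → f (Quot.mk _ I) = Quot.mk _ J) :
    Function.Injective f := by
  intro t t' htt'
  induction t using Quot.ind with
  | mk I =>
    induction t' using Quot.ind with
    | mk I' =>
      obtain ⟨a, ha, hI⟩ := (hC₁ I.1).mp I.2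
      obtain ⟨b, hb, hI'⟩ := (hC₁ I'.1).mp I'.2
      have hca : C₂.IsCuspidalInertia W.pmHat (MulAut.conj a • J₂) := (hC₂ _).mpr ⟨a, rfl⟩
      have hcb : C₂.IsCuspidalInertia W.pmHat (MulAut.conj b • J₂) := (hC₂ _).mpr ⟨b, rfl⟩
      rw [hf a ha I ⟨_, hca⟩ hI rfl, hf b hb I' ⟨_, hcb⟩ hI' rfl] at htt'
      have hrel : labelRel C₂ W.pmHat W.pmHat ⟨_, hca⟩ ⟨_, hcb⟩ := (labCuspPM_mk_eq_mk_iff C₂ W.pmHat W.pmHat _ _).mp htt'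
      have hmem : a⁻¹ * b ∈ Qsup :=
        hinj ⟨(labelRel_conj_smul_iff hJ₂ hca hcb).mp hrel, R.mul_mem (R.inv_mem ha) hb⟩
      have hc1 : C₁.IsCuspidalInertia Qsub (MulAut.conj a • J₁) := (hC₁ _).mpr ⟨a, ha, rfl⟩
      have hc1' : C₁.IsCuspidalInertia Qsub (MulAut.conj b • J₁) := (hC₁ _).mpr ⟨b, hb, rfl⟩
      have e : I = ⟨MulAut.conj a • J₁, hc1⟩ := Subtype.ext hI
      have e' : I' = ⟨MulAut.conj b • J₁, hc1'⟩ := Subtype.ext hI'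
      rw [e, e']
      exact Quot.sound (labelRel_level_of_inv_mul_mem hJ₁ hRQ ha hb hc1 hc1' hmem)

/-- **THE LEVEL-2 STABILISER MEETS `Π̂_X` INSIDE `Π̂^±_v`** under the inputs of the hatted count (p447018 `card_labCuspPM_eq_l_of_inputs`): an
index-`2`-type subgroup `Π̂_X ⊇ Π̂^±_v`, a subgroup `D ≤ Π̂^±_v` normalising `J₂` with SEPARATION `N(J₂) ∩ Π̂_X ≤ D` ([AbsTopI] Lem 4.5 (vi) at the
instance, a binder) and `J₂` stable under every `q` normalising `D`.  Then `(N(N(J₂) ∩ Π̂^±_v) · Π̂^±_v) ∩ Π̂_X ≤ Π̂^±_v`.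
[claim: Mochizuki2012, status: disputed] (IUTchII §2 Def 2.3 (iii), kurims p.68) -/
theorem sup_inf_le_pmHat_of_inputs {Xh D : Subgroup W.Corhat} (hPX : W.pmHat ≤ Xh) (hDP : D ≤ W.pmHat)
    (hDJ : D ≤ Subgroup.normalizer (J₂ : Set W.Corhat)) (hsep : Subgroup.normalizer (J₂ : Set W.Corhat) ⊓ Xh ≤ D)
    (hJD : ∀ q : W.Corhat, MulAut.conj q • D = D → MulAut.conj q • J₂ = J₂) :
    (Subgroup.normalizer ((Subgroup.normalizer (J₂ : Set W.Corhat) ⊓ W.pmHat : Subgroup W.Corhat) : Set W.Corhat) ⊔ W.pmHat) ⊓ Xh ≤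
      W.pmHat := by
  -- `N(J₂) ∩ Π̂^±_v = D`
  have hN₀ : Subgroup.normalizer (J₂ : Set W.Corhat) ⊓ W.pmHat = D :=
    le_antisymm ((inf_le_inf_left _ hPX).trans hsep) (le_inf hDJ hDP)
  rw [hN₀]
  rintro x ⟨hx, hxX⟩
  obtain ⟨p, hp, n, hn, rfl⟩ := mem_sup_normal_iff.mp hx
  -- `n = p⁻¹ (p n) ∈ Π̂_X` normalises `D`, hence `J₂`, hence lies in `D ≤ Π̂^±_v`
  have hnX : n ∈ Xh := by
    have : n = p⁻¹ * (p * n) := by rw [inv_mul_cancel_left]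
    rw [this]
    exact Xh.mul_mem (Xh.inv_mem (hPX hp)) hxX
  have hnJ : MulAut.conj n • J₂ = J₂ := hJD n (mem_normalizer_iff_conj_smul_eq.mp hn)
  exact W.pmHat.mul_mem hp (hDP (hsep ⟨mem_normalizer_iff_conj_smul_eq.mpr hnJ, hnX⟩))

/-- **INJECTIVE + EQUAL FINITE COUNTS ⇒ BIJECTIVE**: at the genuine tower both `|LabCusp^±(Π_v)|` (p456452) and `|LabCusp^±(Π̂^±_v)|` (p449023)
equal `l`, so the injective level map is a BIJECTION `LabCusp^±(Π_v) ≃ LabCusp^±(Π̂^±_v)`.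
[claim: Mochizuki2012, status: disputed] (IUTchII §2 Def 2.3 (v), kurims p.69) -/
theorem levelMap_bijective_of_card_eq {Qsub' Qsup' : Subgroup W.Corhat}
    {f : LabCuspPM C₁ Qsub Qsup → LabCuspPM C₂ Qsub' Qsup'} (hf : Function.Injective f) {n : ℕ} (hn : n ≠ 0)
    (h₁ : Nat.card (LabCuspPM C₁ Qsub Qsup) = n) (h₂ : Nat.card (LabCuspPM C₂ Qsub' Qsup') = n) :
    Function.Bijective f := by
  haveI : Finite (LabCuspPM C₂ Qsub' Qsup') := Nat.finite_of_card_ne_zero (by rw [h₂]; exact hn)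
  exact hf.bijective_of_nat_card_le (by rw [h₁, h₂])

end LevelMap

/-! ## 2. The tie of the `𝔽^±_l`-torsor chart to the level-`Π_v` structure (law (b) of G-w5d243-2) -/

section Tie

variable {C₁ C₂ : CuspidalInertiaData W}

/-- **LAW (b) IS SATISFIABLE — the level-`Π_v` structure as the PULLBACK of the chart.**  For a bijective level map
`f : LabCusp^±(Π_v) → LabCusp^±(Π̂^±_v)` and any `𝔽^±_l`-torsor datum `F` on `LabCusp^±(Π̂^±_v)` there is a Def 2.3 (iii) structure `L` on
`LabCusp^±(Π_v)` (`𝔽_l^×`-action, zero element, `±`-canonical element) with `L.toFl = F.chart ∘ f`: «the images … of the various structures on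
`LabCusp^±(Π_v)`» and the torsor chart AGREE (`chart_imageV` with `ε = 1`, `a = 0`).
[claim: Mochizuki2012, status: disputed] (IUTchII §2 Def 2.3 (v), kurims p.69) -/
theorem exists_labCuspStructure_toFl_eq_chart_comp
    {f : LabCuspPM C₁ W.piV W.piPM → LabCuspPM C₂ W.pmHat W.pmHat} (hf : Function.Bijective f) (F : FlTorsorStructure C₂) :
    ∃ L : LabCuspStructure C₁, (∀ t, L.toFl t = F.chart (f t)) ∧ f L.eta0 = F.chart.symm 0 ∧ f L.etaPM = F.chart.symm 1 := by
  let e : LabCuspPM C₁ W.piV W.piPM ≃ ZMod S.l := (Equiv.ofBijective f hf).trans F.chart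
  refine ⟨{ act := fun a t => e.symm ((a : ZMod S.l) * e t)
            act_one := fun t => by simp
            act_mul := fun a b t => by simp [mul_assoc]
            eta0 := e.symm 0
            etaPM := e.symm 1
            toFl := e
            toFl_eta0 := by simp
            toFl_etaPM := Or.inl (by simp)
            toFl_act := fun a t => by simp }, fun t => rfl, ?_, ?_⟩
  · change f (e.symm 0) = _
    change (Equiv.ofBijective f hf) (((Equiv.ofBijective f hf).trans F.chart).symm 0) = _
    simp
  · change (Equiv.ofBijective f hf) (((Equiv.ofBijective f hf).trans F.chart).symm 1) = _
    simp

/-- The same in the printed affine shape of the wanted law `chart_imageV`: `∃ L a ε, ∀ t, F.chart (f t) = ε · L.toFl t + a`.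
[claim: Mochizuki2012, status: disputed] (IUTchII §2 Def 2.3 (v), kurims p.69) -/
theorem exists_labCuspStructure_chart_comp_affine
    {f : LabCuspPM C₁ W.piV W.piPM → LabCuspPM C₂ W.pmHat W.pmHat} (hf : Function.Bijective f) (F : FlTorsorStructure C₂) :
    ∃ (L : LabCuspStructure C₁) (a : ZMod S.l) (ε : ℤˣ), ∀ t, F.chart (f t) = ((ε : ℤ) : ZMod S.l) * L.toFl t + a := by
  obtain ⟨L, hL, -, -⟩ := exists_labCuspStructure_toFl_eq_chart_comp hf F
  exact ⟨L, 0, 1, fun t => by rw [hL, Units.val_one, Int.cast_one, one_mul, add_zero]⟩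

/-- **RIGIDITY UNDER THE LAW — «hence determines a natural OUTER isomorphism».**  Fix a level-`Π_v` structure `L` and a SURJECTIVE level map `f`.
If two successor structures `F F' : FlTorsorStructureConj C₂` both satisfy law (b) against `(L, f)` — `F.chart (f t) = ε · L.toFl t + a`,
`F'.chart (f t) = ε' · L.toFl t + a'` — then `F'.chart = (ε'ε) · F.chart + (a' − ε'ε a)`: the two charts lie in ONE `𝔽_l^{⋊±}`-orbit, so
(abc-iut-w5-d243 p441293 `exists_quotIso_eq_conj`) the two isomorphisms `Π̂^cor_v/Π̂^±_v ≃* 𝔽_l^{⋊±}` are CONJUGATE by an element of `𝔽_l^{⋊±}`.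
[claim: Mochizuki2012, status: disputed] (IUTchII §2 Def 2.3 (v), kurims p.69) -/
theorem exists_quotIso_eq_conj_of_chart_comp_affine
    {f : LabCuspPM C₁ W.piV W.piPM → LabCuspPM C₂ W.pmHat W.pmHat} (hf : Function.Surjective f) (L : LabCuspStructure C₁)
    (F F' : FlTorsorStructureConj C₂) {a a' : ZMod S.l} {ε ε' : ℤˣ}
    (h : ∀ t, F.chart (f t) = ((ε : ℤ) : ZMod S.l) * L.toFl t + a) (h' : ∀ t, F'.chart (f t) = ((ε' : ℤ) : ZMod S.l) * L.toFl t + a') :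
    (∀ s, F'.chart s = (((ε' * ε : ℤˣ) : ℤ) : ZMod S.l) * F.chart s + (a' - (((ε' * ε : ℤˣ) : ℤ) : ZMod S.l) * a)) ∧
      ∃ k : Literature.IUT.HodgeTheaters.FlPM S.l, ∀ q, F'.quotIso q = k * F.quotIso q * k⁻¹ := by
  have hεε : ((ε : ℤ) : ZMod S.l) * ((ε : ℤ) : ZMod S.l) = 1 := by
    rw [← Int.cast_mul, Int.units_coe_mul_self, Int.cast_one]
  have key : ∀ s, F'.chart s = (((ε' * ε : ℤˣ) : ℤ) : ZMod S.l) * F.chart s + (a' - (((ε' * ε : ℤˣ) : ℤ) : ZMod S.l) * a) := by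
    intro s
    obtain ⟨t, rfl⟩ := hf s
    have hL : L.toFl t = ((ε : ℤ) : ZMod S.l) * (F.chart (f t) - a) := by
      rw [h t, add_sub_cancel_right, ← mul_assoc, hεε, one_mul]
    rw [h' t, hL, Units.val_mul, Int.cast_mul]
    ring
  exact ⟨key, FlTorsorStructureConj.exists_quotIso_eq_conj F F' (ε' * ε) _ key⟩

/-- Under the law, for every `g ∈ Π̂^cor_v` the two images of `ḡ` in `𝔽_l^{⋊±}` are conjugate (`IsConj`) — the outer class is the same.
[claim: Mochizuki2012, status: disputed] (IUTchII §2 Def 2.3 (v), kurims p.69) -/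
theorem isConj_quotIso_of_chart_comp_affine
    {f : LabCuspPM C₁ W.piV W.piPM → LabCuspPM C₂ W.pmHat W.pmHat} (hf : Function.Surjective f) (L : LabCuspStructure C₁)
    (F F' : FlTorsorStructureConj C₂) {a a' : ZMod S.l} {ε ε' : ℤˣ}
    (h : ∀ t, F.chart (f t) = ((ε : ℤ) : ZMod S.l) * L.toFl t + a) (h' : ∀ t, F'.chart (f t) = ((ε' : ℤ) : ZMod S.l) * L.toFl t + a')
    (q : W.Corhat ⧸ W.pmHat) : IsConj (F.quotIso q) (F'.quotIso q) := by
  obtain ⟨-, k, hk⟩ := exists_quotIso_eq_conj_of_chart_comp_affine hf L F F' h h'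
  exact isConj_iff.mpr ⟨k, by rw [hk q]⟩

/-- **WITHOUT fixing `L` the law pins nothing new** (honest converse): for a bijective `f`, EVERY successor structure `F` satisfies law (b)
against SOME level-`Π_v` structure (namely the pullback of its own chart) — the content of G-w5d243-2 is the SIMULTANEOUS datum `(L, imageV, F)`,
not a property of `F` alone. [claim: Mochizuki2012, status: disputed] (IUTchII §2 Def 2.3 (v), kurims p.69) -/
theorem forall_exists_labCuspStructure_chart_comp_affine
    {f : LabCuspPM C₁ W.piV W.piPM → LabCuspPM C₂ W.pmHat W.pmHat} (hf : Function.Bijective f) :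
    ∀ F : FlTorsorStructureConj C₂, ∃ (L : LabCuspStructure C₁) (a : ZMod S.l) (ε : ℤˣ),
      ∀ t, F.chart (f t) = ((ε : ℤ) : ZMod S.l) * L.toFl t + a :=
  fun F => exists_labCuspStructure_chart_comp_affine hf F.toFlTorsorStructure

end Tie

end Literature.IUT.HodgeArakelov

end
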